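import Mathlib
import Literature.Topology.Euclidean.HairyBall
import HarnessLib

/-!
# A set-valued hairy ball theorem (zeros of upper hemicontinuous convex-valued tangent fields)

**Theorem** (folklore; the Kakutani–Cellina reduction of convex-valued problems to single-valued
ones, applied to the hairy ball theorem). Let `E` be a finite-dimensional real inner product space of
odd dimension and `F : Sᵈ ⇉ E` (`Sᵈ` the unit sphere) an upper hemicontinuous set-valued map with
nonempty closed convex values that are *tangent*: `⟪x, y⟫ = 0` for `y ∈ F x`. Then `0 ∈ F x` for
some `x ∈ Sᵈ`.

For single-valued `F = {c}` this is the hairy ball theorem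
`Literature.Topology.Euclidean.HairyBall.exists_eq_zero_of_tangent` [Milnor1978], which is the
topological input here. The reduction: if `0 ∉ F x` for every `x`, strict separation
(`geometric_hahn_banach_point_closed`) gives `v_x` with `⟪v_x, ·⟫ > 0` on `F x`; by upper
hemicontinuity the same `v_x` works on `F z` for `z` near `x`; a partition of unity over a finite
subcover glues a *continuous* `w` with `⟪w x, y⟫ > 0` for all `y ∈ F x`
(`exists_continuous_forall_inner_pos` — the same device as in the proof of Cellina's approximate
selection theorem, Borwein–Lewis, *Convex Analysis and Nonlinear Optimization*, §8.2); its tangential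
part `x ↦ w x - ⟪x, w x⟫ x` is a continuous tangent field that vanishes nowhere (test against any
tangent `y ∈ F x`), which the hairy ball theorem forbids.

Main results (namespace `Literature.Topology.Euclidean.SetValuedHairyBall`):

* `upperHemicontinuousOn_of_isCompact_graph` (private) — a set-valued map whose graph over `s` is compact is
  upper hemicontinuous on `s` (Hausdorff domain);
* `exists_continuous_forall_inner_pos` (private) — the separation / partition-of-unity lemma above (any real
  inner product space `E`, any compact `K` in a metric space);
* `exists_zero_mem_of_tangent` — **the set-valued hairy ball theorem** (tangent form);
* `exists_aligned_of_isCompact_graph`, `exists_aligned_of_isClosed_graph` — **hemisphere form**: if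
  instead the values lie in the closed hemisphere `⟪x, y⟫ ≥ 0` (compact graph over the sphere, resp.
  closed graph and bounded values), then some value is *aligned*: `y ∈ K x` with `y = ‖y‖ x`
  (apply the tangent form to the tangential projections `y - ⟪x, y⟫ x` of the values).

The hemisphere form over `EuclideanSpace ℝ (Fin 3)` is, hypothesis for hypothesis, the statement
`stub_setValuedHairyBall` of the skeleton
`Summits/AnomalousDissipation/AnomalousDissipation/Cruxes/HairyBallAlignment/Lines/birth.lean`
(crux `Summit.AnomalousDissipation.AnomalousDissipation.Theses.StirringSphere.HairyBallAlignment`),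
whose docstring sketches exactly this argument. No definitions; no named facts; sorry-free.

## References

* J. Milnor, *Analytic proofs of the "hairy ball theorem" and the Brouwer fixed point theorem*,
  Amer. Math. Monthly 85 (1978), 521–524 [Milnor1978] — via `HairyBall.exists_eq_zero_of_tangent`.
* J. M. Borwein, A. S. Lewis, *Convex Analysis and Nonlinear Optimization* (2000), §8.2
  (Kakutani–Fan, Cellina: the USC/partition-of-unity technique) [BorweinLewis2000].
* J.-P. Aubin, *Optima and Equilibria* (1993), Thm 9.4 (zeros of set-valued maps satisfying the
  tangential condition on a convex compact set — the convex-domain analogue; not used).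
-/

open Set Metric Filter Topology
open scoped RealInnerProductSpace

namespace Literature.Topology.Euclidean.SetValuedHairyBall

/-! ## Compact graph ⇒ upper hemicontinuous -/

/-- A set-valued map `Ω` whose graph `{(x, y) | x ∈ s, y ∈ Ω x}` over `s` is compact is upper
hemicontinuous on `s` (Hausdorff domain `α`, any `β`): for an open `U ⊇ Ω a` the projection of the
compact set `graph ∩ (α × Uᶜ)` is closed and misses `a`. [folklore] -/
private theorem upperHemicontinuousOn_of_isCompact_graph {α β : Type*} [TopologicalSpace α] [T2Space α]
    [TopologicalSpace β] {Ω : α → Set β} {s : Set α}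
    (hgraph : IsCompact {p : α × β | p.1 ∈ s ∧ p.2 ∈ Ω p.1}) : UpperHemicontinuousOn Ω s := by
  refine upperHemicontinuousOn_iff_forall_isOpen.2 fun a _ U hU haU => ?_
  set S : Set (α × β) := {p : α × β | p.1 ∈ s ∧ p.2 ∈ Ω p.1} ∩ Prod.snd ⁻¹' Uᶜ with hS
  have hSc : IsCompact S := hgraph.inter_right (hU.isClosed_compl.preimage continuous_snd)
  have hP : IsClosed (Prod.fst '' S) := (hSc.image continuous_fst).isClosed
  have haP : a ∉ Prod.fst '' S := by
    rintro ⟨q, ⟨hq, hqU⟩, hqa⟩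
    rw [← hqa] at haU
    exact hqU (haU hq.2)
  have hev : ∀ᶠ z in 𝓝 a, z ∉ Prod.fst '' S := hP.isOpen_compl.mem_nhds haP
  refine eventually_nhdsWithin_iff.2 (hev.mono fun z hz hzs y hy => ?_)
  by_contra hyU
  exact hz ⟨(z, y), ⟨⟨hzs, hy⟩, hyU⟩, rfl⟩
#harness_tags upperHemicontinuousOn_of_isCompact_graph

/-! ## Separation and a partition of unity -/

section Field

variable {X : Type*} [MetricSpace X]
variable {E : Type*} [NormedAddCommGroup E] [InnerProductSpace ℝ E] [CompleteSpace E]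

/-- **Gluing strictly separating directions.** If `F` is upper hemicontinuous on a compact set `K`
with closed convex values none of which contains `0`, then there is a *continuous* `w : X → E` with
`⟪w x, y⟫ > 0` for all `x ∈ K`, `y ∈ F x`. (Strict separation of `0` from each `F x`
(`geometric_hahn_banach_point_closed`), valid on `F z` for `z` near `x` by upper hemicontinuity; a
finite subcover of `K` and the partition of unity `max 0 (δ_c - dist z c)`; positivity of the glued
pairing by `Finset.sum_pos'`.) This is the device of the proof of Cellina's theorem, Borwein–Lewis
§8.2. [folklore] -/
private theorem exists_continuous_forall_inner_pos {K : Set X} (hK : IsCompact K) {F : X → Set E}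
    (hF : UpperHemicontinuousOn F K) (hcl : ∀ x ∈ K, IsClosed (F x))
    (hconv : ∀ x ∈ K, Convex ℝ (F x)) (h0 : ∀ x ∈ K, (0 : E) ∉ F x) :
    ∃ w : X → E, Continuous w ∧ ∀ x ∈ K, ∀ y ∈ F x, 0 < ⟪w x, y⟫ := by
  classical
  -- strictly separating vectors, valid on `F z` for `z ∈ K` near `x`
  have hsep : ∀ x, ∃ v : E, ∃ δ : ℝ, 0 < δ ∧
      (x ∈ K → ∀ z ∈ K, dist z x < δ → ∀ y ∈ F z, 0 < ⟪v, y⟫) := by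
    intro x
    by_cases hx : x ∈ K
    · obtain ⟨f, s, hs0, hsF⟩ :=
        geometric_hahn_banach_point_closed (hconv x hx) (hcl x hx) (h0 x hx)
      have hs : 0 < s := by simpa using hs0
      have hopen : IsOpen {y : E | 0 < f y} := isOpen_lt continuous_const f.continuous
      have hFU : F x ⊆ {y | 0 < f y} := fun y hy => hs.trans (hsF y hy)
      have hev := (upperHemicontinuousOn_iff_forall_isOpen.1 hF) x hx _ hopen hFU
      obtain ⟨δ, hδ, hδU⟩ := Metric.mem_nhdsWithin_iff.1 hev
      refine ⟨(InnerProductSpace.toDual ℝ E).symm f, δ, hδ, fun _ z hz hzx y hy => ?_⟩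
      rw [InnerProductSpace.toDual_symm_apply]
      exact hδU ⟨mem_ball.2 hzx, hz⟩ hy
    · exact ⟨0, 1, one_pos, fun h => absurd h hx⟩
  choose v δ hδpos hvpos using hsep
  -- a finite subcover of `K` by the balls `ball x (δ x)`, centres in `K`
  obtain ⟨t, htK, hcover⟩ := hK.elim_nhds_subcover (fun x => ball x (δ x))
    (fun x _ => ball_mem_nhds x (hδpos x))
  have hcov : ∀ z ∈ K, ∃ c ∈ t, dist z c < δ c := fun z hz => by
    simpa only [mem_iUnion, mem_ball, exists_prop] using hcover hz
  -- partition-of-unity weights and the glued field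
  set wt : X → X → ℝ := fun c z => max 0 (δ c - dist z c) with hwt
  have hwt_nonneg : ∀ c z, 0 ≤ wt c z := fun c z => le_max_left _ _
  have hwt_cont : ∀ c, Continuous (wt c) := fun c =>
    continuous_const.max (continuous_const.sub (continuous_id.dist continuous_const))
  have hwt_pos_iff : ∀ c z, 0 < wt c z ↔ dist z c < δ c := fun c z => by
    simp only [hwt, lt_max_iff, lt_self_iff_false, false_or, sub_pos]
  refine ⟨fun z => ∑ c ∈ t, wt c z • v c,
    continuous_finsetSum _ fun c _ => (hwt_cont c).smul continuous_const, fun z hz y hy => ?_⟩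
  rw [sum_inner]
  simp only [real_inner_smul_left]
  obtain ⟨c₀, hc₀t, hzc₀⟩ := hcov z hz
  refine Finset.sum_pos' (fun c hc => ?_) ⟨c₀, hc₀t, ?_⟩
  · rcases (hwt_nonneg c z).eq_or_lt with h0 | hpos
    · rw [← h0, zero_mul]
    · exact (mul_pos hpos (hvpos c (htK c hc) z hz ((hwt_pos_iff c z).1 hpos) y hy)).le
  · exact mul_pos ((hwt_pos_iff c₀ z).2 hzc₀) (hvpos c₀ (htK c₀ hc₀t) z hz hzc₀ y hy)
#harness_tags exists_continuous_forall_inner_pos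

end Field

/-! ## The set-valued hairy ball theorem -/

section Sphere

variable {E : Type*} [NormedAddCommGroup E] [InnerProductSpace ℝ E] [FiniteDimensional ℝ E]

/-- **Set-valued hairy ball theorem (tangent form).** If `dim E` is odd and `F` is upper
hemicontinuous on the unit sphere with nonempty closed convex *tangent* values (`⟪x, y⟫ = 0` for
`y ∈ F x`), then `0 ∈ F x` for some unit vector `x`. (Otherwise `exists_continuous_forall_inner_pos`
gives a continuous `w` pairing positively with every value; its tangential part
`x ↦ w x - ⟪x, w x⟫ x` is a nowhere-vanishing continuous tangent field, contradicting
`HairyBall.exists_eq_zero_of_tangent` [Milnor1978].) [cite: Milnor1978, Theorem 1 (hairy ball theorem: no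
nonvanishing continuous tangent field on an even-dimensional sphere) — set-valued corollary (upper
hemicontinuous map, closed convex tangent values) by the Cellina / Kakutani–Fan partition-of-unity reduction
of BorweinLewis2000 §8.2; the combination is folklore] -/
theorem exists_zero_mem_of_tangent (hE : Odd (Module.finrank ℝ E)) {F : E → Set E}
    (hF : UpperHemicontinuousOn F (sphere (0 : E) 1))
    (hne : ∀ x ∈ sphere (0 : E) 1, (F x).Nonempty) (hcl : ∀ x ∈ sphere (0 : E) 1, IsClosed (F x))
    (hconv : ∀ x ∈ sphere (0 : E) 1, Convex ℝ (F x))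
    (htan : ∀ x ∈ sphere (0 : E) 1, ∀ y ∈ F x, ⟪x, y⟫ = 0) :
    ∃ x ∈ sphere (0 : E) 1, (0 : E) ∈ F x := by
  haveI : CompleteSpace E := FiniteDimensional.complete ℝ E
  by_contra H
  push Not at H
  obtain ⟨w, hw, hpos⟩ := exists_continuous_forall_inner_pos (isCompact_sphere 0 1) hF hcl hconv H
  -- the tangential part of `w` is a continuous tangent field
  set c : E → E := fun x => w x - ⟪x, w x⟫ • x with hc
  have hcc : Continuous c := hw.sub ((continuous_id.inner hw).smul continuous_id)
  have hctan : ∀ x ∈ sphere (0 : E) 1, ⟪x, c x⟫ = 0 := fun x hx => by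
    have hxx : ⟪x, x⟫ = 1 := by
      rw [real_inner_self_eq_norm_sq, mem_sphere_zero_iff_norm.1 hx, one_pow]
    simp only [hc, inner_sub_right, real_inner_smul_right, hxx, mul_one, sub_self]
  -- … which vanishes somewhere (hairy ball), contradicting positivity against a tangent value
  obtain ⟨x, hx, hx0⟩ := HairyBall.exists_eq_zero_of_tangent hE hcc.continuousOn hctan
  obtain ⟨y, hy⟩ := hne x hx
  have hwx : w x = ⟪x, w x⟫ • x := sub_eq_zero.1 hx0
  have h0 : ⟪w x, y⟫ = 0 := by rw [hwx, real_inner_smul_left, htan x hx y hy, mul_zero]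
  exact (hpos x hx y hy).ne' h0
#harness_tags exists_zero_mem_of_tangent

omit [FiniteDimensional ℝ E] in
/-- The tangential projection `y ↦ y - ⟪c, y⟫ c` is linear in `y`. [folklore] -/
private theorem isLinearMap_tangentialPart (c : E) : IsLinearMap ℝ fun y : E => y - ⟪c, y⟫ • c where
  map_add y₁ y₂ := by simp only [inner_add_right, add_smul]; abel
  map_smul a y := by rw [real_inner_smul_right, smul_sub, smul_smul]

/-- **Set-valued hairy ball theorem (hemisphere form, compact graph).** If `dim E` is odd and
`K : Sᵈ ⇉ E` has compact graph over the unit sphere, nonempty convex values, and every value lies in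
the closed hemisphere `⟪x, y⟫ ≥ 0`, then some value is *aligned* with its base point: `y ∈ K x` with
`y = ‖y‖ x`. (Apply the tangent form to the tangential projections `{y - ⟪x, y⟫ x | y ∈ K x}`, whose
graph is a continuous image of the graph of `K`; a zero there is a `y ∈ K x` with `y = ⟪x, y⟫ x`,
`⟪x, y⟫ ≥ 0`.) [cite: Milnor1978, Theorem 1 (hairy ball theorem) — hemisphere/alignment form of the
set-valued corollary, reduction as in BorweinLewis2000 §8.2 (Cellina / Kakutani–Fan); folklore combination]
-/
theorem exists_aligned_of_isCompact_graph (hE : Odd (Module.finrank ℝ E)) {K : E → Set E}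
    (hgraph : IsCompact {p : E × E | p.1 ∈ sphere (0 : E) 1 ∧ p.2 ∈ K p.1})
    (hne : ∀ x ∈ sphere (0 : E) 1, (K x).Nonempty) (hconv : ∀ x ∈ sphere (0 : E) 1, Convex ℝ (K x))
    (hhemi : ∀ x ∈ sphere (0 : E) 1, ∀ y ∈ K x, 0 ≤ ⟪x, y⟫) :
    ∃ x ∈ sphere (0 : E) 1, ∃ y ∈ K x, y = ‖y‖ • x := by
  -- tangential projections of the values
  set P : E × E → E × E := fun p => (p.1, p.2 - ⟪p.1, p.2⟫ • p.1) with hP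
  have hPc : Continuous P :=
    continuous_fst.prodMk (continuous_snd.sub ((continuous_fst.inner continuous_snd).smul
      continuous_fst))
  set F : E → Set E := fun x => (fun y => y - ⟪x, y⟫ • x) '' K x with hFdef
  have hGF : {p : E × E | p.1 ∈ sphere (0 : E) 1 ∧ p.2 ∈ F p.1} =
      P '' {p : E × E | p.1 ∈ sphere (0 : E) 1 ∧ p.2 ∈ K p.1} := by
    ext ⟨x, z⟩
    constructor
    · rintro ⟨hx, y, hy, hyz⟩
      have hyz' : y - ⟪x, y⟫ • x = z := by simpa using hyz
      exact ⟨(x, y), ⟨hx, hy⟩, by simp only [hP, hyz']⟩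
    · rintro ⟨⟨x', y⟩, ⟨hx', hy⟩, hq⟩
      simp only [hP, Prod.mk.injEq] at hq
      obtain ⟨rfl, rfl⟩ := hq
      exact ⟨hx', y, hy, rfl⟩
  have hF : UpperHemicontinuousOn F (sphere (0 : E) 1) :=
    upperHemicontinuousOn_of_isCompact_graph (by rw [hGF]; exact hgraph.image hPc)
  -- the values `K x` (slices of the compact graph) are compact, hence so are their projections
  have hKc : ∀ x ∈ sphere (0 : E) 1, IsCompact (K x) := by
    intro x hx
    have himage : K x = Prod.snd '' ({p : E × E | p.1 ∈ sphere (0 : E) 1 ∧ p.2 ∈ K p.1} ∩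
        Prod.fst ⁻¹' {x}) := by
      ext y
      constructor
      · intro hy
        exact ⟨(x, y), ⟨⟨hx, hy⟩, rfl⟩, rfl⟩
      · rintro ⟨⟨x', y'⟩, ⟨⟨-, hy'⟩, hx'⟩, rfl⟩
        simp only [mem_preimage, mem_singleton_iff] at hx'
        subst hx'
        exact hy'
    rw [himage]
    exact (hgraph.inter_right (isClosed_singleton.preimage continuous_fst)).image continuous_snd
  have hFne : ∀ x ∈ sphere (0 : E) 1, (F x).Nonempty := fun x hx => (hne x hx).image _
  have hFcl : ∀ x ∈ sphere (0 : E) 1, IsClosed (F x) := fun x hx =>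
    ((hKc x hx).image (continuous_id.sub ((continuous_const.inner continuous_id).smul
      continuous_const))).isClosed
  have hFconv : ∀ x ∈ sphere (0 : E) 1, Convex ℝ (F x) := fun x hx =>
    (hconv x hx).is_linear_image (isLinearMap_tangentialPart x)
  have hFtan : ∀ x ∈ sphere (0 : E) 1, ∀ z ∈ F x, ⟪x, z⟫ = 0 := by
    rintro x hx z ⟨y, -, rfl⟩
    have hxx : ⟪x, x⟫ = 1 := by
      rw [real_inner_self_eq_norm_sq, mem_sphere_zero_iff_norm.1 hx, one_pow]
    simp only [inner_sub_right, real_inner_smul_right, hxx, mul_one, sub_self]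
  obtain ⟨x, hx, hx0⟩ := exists_zero_mem_of_tangent hE hF hFne hFcl hFconv hFtan
  obtain ⟨y, hy, hy0⟩ := hx0
  refine ⟨x, hx, y, hy, ?_⟩
  have hyx : y = ⟪x, y⟫ • x := (sub_eq_zero.1 hy0)
  have hnorm : ‖y‖ = ⟪x, y⟫ := by
    rw [hyx, norm_smul, Real.norm_eq_abs, abs_of_nonneg (hhemi x hx y hy),
      mem_sphere_zero_iff_norm.1 hx, mul_one, real_inner_smul_right, real_inner_self_eq_norm_sq,
      mem_sphere_zero_iff_norm.1 hx, one_pow, mul_one]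
  rw [hnorm]
  exact hyx
#harness_tags exists_aligned_of_isCompact_graph

/-- **Set-valued hairy ball theorem (hemisphere form, closed graph and bounded values).** If
`dim E` is odd and `K : Sᵈ ⇉ E` has closed graph over the unit sphere, uniformly bounded, nonempty,
convex values lying in the closed hemisphere `⟪c, y⟫ ≥ 0`, then `y = ‖y‖ c` for some unit `c` and
`y ∈ K c`. Over `EuclideanSpace ℝ (Fin 3)` this is, hypothesis for hypothesis, the statement
`stub_setValuedHairyBall` of `Summits/AnomalousDissipation/…/Cruxes/HairyBallAlignment/Lines/birth.lean`.
(The graph is closed and bounded, hence compact: `exists_aligned_of_isCompact_graph`.) Every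
hypothesis is load-bearing: `K = ∅`; `K c = {-c}`; the unit tangent circle `K c = {t ⊥ c, ‖t‖ = 1}`
(not convex); a discontinuous tangent selection (graph not closed). [cite: Milnor1978, Theorem 1 (hairy ball
theorem) — closed-graph hemisphere/alignment form of the set-valued corollary, reduction as in
BorweinLewis2000 §8.2 (Cellina / Kakutani–Fan); folklore combination] -/
theorem exists_aligned_of_isClosed_graph (hE : Odd (Module.finrank ℝ E)) (K : E → Set E)
    (hgraph : IsClosed {p : E × E | ‖p.1‖ = 1 ∧ p.2 ∈ K p.1})
    (hbdd : ∃ R : ℝ, ∀ c y : E, ‖c‖ = 1 → y ∈ K c → ‖y‖ ≤ R)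
    (hconv : ∀ c : E, ‖c‖ = 1 → Convex ℝ (K c))
    (hne : ∀ c : E, ‖c‖ = 1 → (K c).Nonempty)
    (hhemi : ∀ c y : E, ‖c‖ = 1 → y ∈ K c → 0 ≤ ⟪c, y⟫) :
    ∃ c y : E, ‖c‖ = 1 ∧ y ∈ K c ∧ y = ‖y‖ • c := by
  obtain ⟨R, hR⟩ := hbdd
  have hGK : IsCompact {p : E × E | p.1 ∈ sphere (0 : E) 1 ∧ p.2 ∈ K p.1} := by
    have heq : {p : E × E | p.1 ∈ sphere (0 : E) 1 ∧ p.2 ∈ K p.1} =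
        {p : E × E | ‖p.1‖ = 1 ∧ p.2 ∈ K p.1} := by
      ext p
      simp only [mem_setOf_eq, mem_sphere_zero_iff_norm]
    rw [heq]
    refine Metric.isCompact_of_isClosed_isBounded hgraph ?_
    refine ((isBounded_closedBall (x := (0 : E)) (r := 1)).prod
      (isBounded_closedBall (x := (0 : E)) (r := R))).subset ?_
    rintro ⟨c, y⟩ ⟨hc, hy⟩
    exact ⟨mem_closedBall_zero_iff.2 (le_of_eq hc), mem_closedBall_zero_iff.2 (hR c y hc hy)⟩
  obtain ⟨c, hc, y, hy, hyc⟩ := exists_aligned_of_isCompact_graph hE hGK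
    (fun c hc => hne c (mem_sphere_zero_iff_norm.1 hc))
    (fun c hc => hconv c (mem_sphere_zero_iff_norm.1 hc))
    (fun c hc y hy => hhemi c y (mem_sphere_zero_iff_norm.1 hc) hy)
  exact ⟨c, y, mem_sphere_zero_iff_norm.1 hc, hy, hyc⟩
#harness_tags exists_aligned_of_isClosed_graph

/-- The `EuclideanSpace ℝ (Fin 3)` instance (the consumer's `stub_setValuedHairyBall`, verbatim up to the
spelling `⟪c, y⟫_ℝ` of the real inner product). -/
example : ∀ K : EuclideanSpace ℝ (Fin 3) → Set (EuclideanSpace ℝ (Fin 3)),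
    IsClosed {p : EuclideanSpace ℝ (Fin 3) × EuclideanSpace ℝ (Fin 3) | ‖p.1‖ = 1 ∧ p.2 ∈ K p.1} →
    (∃ R : ℝ, ∀ (c y : EuclideanSpace ℝ (Fin 3)), ‖c‖ = 1 → y ∈ K c → ‖y‖ ≤ R) →
    (∀ c : EuclideanSpace ℝ (Fin 3), ‖c‖ = 1 → Convex ℝ (K c)) →
    (∀ c : EuclideanSpace ℝ (Fin 3), ‖c‖ = 1 → (K c).Nonempty) →
    (∀ (c y : EuclideanSpace ℝ (Fin 3)), ‖c‖ = 1 → y ∈ K c → 0 ≤ ⟪c, y⟫) →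
      ∃ (c y : EuclideanSpace ℝ (Fin 3)), ‖c‖ = 1 ∧ y ∈ K c ∧ y = ‖y‖ • c :=
  fun K hgraph hbdd hconv hne hhemi =>
    exists_aligned_of_isClosed_graph (by rw [finrank_euclideanSpace_fin]; decide) K hgraph hbdd
      hconv hne hhemi

end Sphere

end Literature.Topology.Euclidean.SetValuedHairyBall
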